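import Summits.BirchSwinnertonDyer.BirchSwinnertonDyer.Theorems.UniversalToricDescentWildSplitWaldspurgerManinDisplay
import HarnessLib

/-!
# Crux `PrintCf2.SplitBadTwoRankOneOfFacts` (item 20368), line `eisenstein_two_bdp_line` (skeleton of record d31d09ce), cut D2b of
# `stub_descent_two`: the Liu–Zhang–Zhang road at an additive prime WITHOUT `p ≠ 2` — the BDP display tends to
# `u·(log_{ω_E} P / c)²` with `‖u‖ = ‖2‖_p` EXACTLY, and EVERY ♭-frame has that value at `𝟙` granted an interpolation supply

Cell `bsd-print-cf2`, seat `bsd-line-cf2-p1-w2` (prover, width seat on crux stmt-BirchSwinnertonDyer-20368; lead `bsd-line-cf2-p1` g5,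
line of record `Lines/eisenstein_two_bdp_line.lean`, skeleton d31d09ce, 2026-08-28). `--supports stmt-BirchSwinnertonDyer-20368` (helper).
Theses-free; THEOREMS ONLY (0 definitions, 0 named facts, 0 `sorry`); every statement is CONDITIONAL on the displayed refereed input
`hF : LiuZhangZhang2018.thm151_thm153_modularCurve_heegnerVector_additive` (Liu–Zhang–Zhang, Duke Math. J. 167 (2018) Thm 1.5.1 ∧ 1.5.3
at a prime `p² ∣ N` split in `K`, typed in the tree for EVERY prime — a conjunct of the line's `stub_prints_two`). BSD is proved for no
curve by any of this; no summit statement is proved by this seat.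

WHAT THIS IS. The lead's cut of the registered `stub_descent_two` (PICKED.md / STATUS 2026-08-28T08:54:44Z) names three pieces: D2a
(exact (∅,0) control at `T = 0` with the `2`-torsion term; research, pen bsd-idea-7), **D2b (the LZZ `2^{1−2n}·(2/h_K)²·u_K·c²`
bookkeeping as a pure valuation identity against `hF`)** and D2c (composition with `P2.bsdp_two_iff_cmHeegnerIndex`). This file is D2b's
analytic half, obtained by auditing the odd-`p` road of cell bsd-potss (`UniversalToricDescentWaldspurgerFlat.exists_exactDisplay_manin`
/ `exists_continuousDisplay_manin` / `intSeries_value_of_frame_manin`, p-odd) for its uses of `p ≠ 2`. FINDING (numbers): `p ≠ 2` is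
used EXACTLY twice on that road — (1) `‖ι⁻¹(2)‖ = 1` in the constant `u = ι⁻¹(8/(s·2²·√|d_K|))` of the value at `𝟙`; (2) the
interpolation-character SUPPLY `X11b.exists_interpolationSupply_pow` (anticyclotomic Hecke characters of type `(m p^k, −m p^k)` with
`2`-adic avatars through `κ`; its proof uses `x² = 1 ⟹ x = 1` for principal units, false at `2`). Nothing else: LZZ's `2^{1−2n}`,
`(2/h_K)²`, `u_K = 2`, `ζ(2) = π²/6`, the virtual period `(π²/4·ϖ^{v_p N})^{1/4}` and the Manin constant all sit inside the EXACT
display identity, which is prime-free. Hence: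
* §1 `exists_exactDisplay_manin_anyPrime`, `exists_continuousDisplay_manin_anyPrime` — the display for EVERY `p` with `‖u‖ = ‖2‖_p`
  (so at `p = 2`: `ord₂ (value at 𝟙) = 1 + 2·ord₂ (log_{ω_E} P / c)` — ONE net factor of `2`);
* §2 (companion file `PrintCf2SplitBadEisensteinTwoFrameValue.lean`) `intSeries_value_of_frame_manin_of_supply` — for EVERY `p`, EVERY ♭-frame `(Ω_K′, Ω_p′, Q′)` (`R1.IsBDPLFunctionInt`) has
  `Q′(𝟙) = u·(log_ω P/c)²`, `‖u‖ = ‖2‖_p`, GRANTED an interpolation supply in the exact shape of the conclusion of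
  `X11b.exists_interpolationSupply_pow` (X11b's rigidity `intSeries_constantCoeff_eq_of_isBDPLFunctionInt_of_tendsto` is prime-free);
  `intSeries_value_of_frame_manin_two_of_supply` — the literal `p = 2` instance for the line. The supply at `p = 2` is the one
  remaining input of D2b (a class-field-theoretic existence statement about `K″`, not about `W`; typed here as a hypothesis VERBATIM in
  the tree's shape, to be discharged by porting `X11b.LambdaSupplyPrime` to `p = 2` with squares of principal units).

References: [LiuZhangZhang2018] Duke Math. J. 167 (2018) Thm 1.5.1, Remark 1.1.2, Thm 1.5.3; [Castella2018] Thms. 3.1–3.2 (shapes);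
[CastellaHsieh2018] §3.3; [Washington1997] §5.1, §7.1; [EdixhovenManin1991] §1; [Greenberg1987] §2.
-/

set_option autoImplicit false

-- D-0017 layout: summit = sub-problem, so `Summit.BirchSwinnertonDyer.BirchSwinnertonDyer.…` is the mandated namespace of Theorems files.
set_option linter.dupNamespace false

noncomputable section

open scoped Classical MatrixGroups ModularForm Topology NumberField

namespace Summit.BirchSwinnertonDyer.BirchSwinnertonDyer.Theorems.PrintCf2.EisensteinTwo

open Filter CongruenceSubgroup WeierstrassCurve NumberField IsDedekindDomain Field PowerSeries
  Literature.NumberTheory.EllipticCurves Literature.NumberTheory.EllipticCurves.ModularForms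
  Literature.NumberTheory.EllipticCurves.LiuZhangZhang2018 Literature.NumberTheory.EllipticCurves.Rank1Residual
  Literature.NumberTheory.GaloisRepresentations
  Summit.BirchSwinnertonDyer.Rank1Residual Summit.BirchSwinnertonDyer.Rank1Residual.X11b
  Summit.BirchSwinnertonDyer.Rank1Residual.X11b.Halves Summit.BirchSwinnertonDyer.Rank1Residual.X2
  Summit.BirchSwinnertonDyer.BirchSwinnertonDyer.Theorems.BiquadraticEisensteinDescentKatzWaldspurgerFrameCMInertBadFlatLZZRoad
  Summit.BirchSwinnertonDyer.BirchSwinnertonDyer.Theorems.UniversalToricDescentWaldspurgerFlat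

/-! ### §1 The LZZ road at an additive prime, Manin-robust, every prime -/

section Rescale

variable {p : ℕ} [Fact p.Prime]

/-- **LZZ 2018 Thm 1.5.1 ∧ 1.5.3 at `p² ∣ N` ⟹ the BDP display EXACTLY, Manin constant KEPT — EVERY prime `p`, the
`2`-power EXPOSED.** Verbatim `UniversalToricDescentWaldspurgerFlat.exists_exactDisplay_manin` (bsd-potss-kmc g19, p-odd) with its
single use of `p ≠ 2` removed: the constant `u = ι⁻¹(8/(s·2²·√|d_K|))` of the value `𝓛(𝟙)·C⁻¹ = u·(log_{ω_E} P / c)²` has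
`‖u‖ = ‖2‖_p` (`= 1` for odd `p`, `= 1/2` at `p = 2`: `‖ι⁻¹ 8‖ = ‖2‖³`, `‖ι⁻¹ 4‖ = ‖2‖²`, `‖ι⁻¹ s‖ = ‖ι⁻¹ √|d_K|‖ = 1` as `p ∤ d_K`).
Virtual periods `Ω_K := 1`, `Ω_p := (ι⁻¹(π²/4)·ϖ^{v_p N})^{1/4}`, constant `C = ι⁻¹(2π·ζ(2)·εp/(L(1,η)L(1,Π,Ad)))`, the kernel's
`σ𝔭`; per character `display = 𝓛(χ)·C⁻¹·r(σ𝔭)^{−v_p N}`. CONDITIONAL on the named fact `hF` (statement-only, refereed source);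
nothing booked. This is the «LZZ `2^{1−2n}(2/h_K)²·u_K·c²` bookkeeping» (D2b of lead cf2-p1 g5's cut of `stub_descent_two`) read
as ONE valuation: every printed constant is a `2`-adic unit except the net factor `2`.
[cite: LiuZhangZhang2018, Thm 1.5.1, Remark 1.1.2, Thm 1.5.3 (Duke Math. J. 167 pp. 746–749)]
[cite: EdixhovenManin1991, §1 (the Manin constant is non-zero)] -/
theorem exists_exactDisplay_manin_anyPrime
    (hF : thm151_thm153_modularCurve_heegnerVector_additive)
    (ι : PadicAlgCl p ≃+* ℂ) (W : WeierstrassCurve ℚ) [W.IsElliptic] [W.IsGloballyMinimal]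
    (K : Type) [Field K] [NumberField K] (𝔭 : HeightOneSpectrum (𝓞 K))
    (κ : ZpExtension K p) (γ : absoluteGaloisGroup K) {N : ℕ} [NeZero N]
    (Dt : ModularParametrizationData W N) (H : HeegnerDatum N (NumberField.discr K))
    (ιK : K →+* ℂ) (e : K →+* ℚ_[p]) (P : (W.baseChange K).toAffine.Point)
    (f : CuspForm (CongruenceSubgroup.Gamma0 N) 2)
    (hN : W.conductorNorm ℤ = N) (hp2N : p ^ 2 ∣ N) (hK : IsImaginaryQuadratic K)
    (hd4 : NumberField.discr K < -4) (hsplit : ((Ideal.span {(p : ℤ)}).primesOver (𝓞 K)).ncard = 2)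
    (h𝔭 : ((p : ℕ) : 𝓞 K) ∈ 𝔭.asIdeal)
    (hι : ∀ (w' : InfinitePlace K) (k : 𝓞 K), k ∈ 𝔭.asIdeal ↔ ‖ι.symm (w'.embedding (k : K))‖ < 1)
    (hHN : SatisfiesHeegnerHypothesis N K) (hκ : κ.IsAnticyclotomic) (hγ : κ.IsTopGenerator γ)
    (hfW : IsNewformOf W f)
    (hP : WeierstrassCurve.Affine.Point.map ιK.toRatAlgHom P = heegnerPointComplex Dt H)
    (he : ∀ k : 𝓞 K, k ∈ 𝔭.asIdeal ↔ ‖e (k : K)‖ < 1) :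
    ∃ (Ωp : ℂ_[p]) (a : ℕ → ℂ_[p]) (C u : ℂ_[p]) (σ𝔭 : absoluteGaloisGroup K),
      Ωp ≠ 0 ∧ (∀ ρ : ℝ, 0 < ρ → ρ < 1 → ∃ B : ℝ, ∀ m : ℕ, ‖a m‖ * ρ ^ m ≤ B) ∧ C ≠ 0 ∧
        ‖u‖ = ‖(2 : ℂ_[p])‖ ∧
      a 0 * C⁻¹ = u * (algebraMap ℚ_[p] ℂ_[p] (Castella2018.padicLogOmega W p e P / (Dt.c : ℚ_[p]))) ^ 2 ∧
      ∀ (φ : HeckeCharacter K) (n : ℕ) (r : FramedGaloisRep K (PadicAlgCl p) 1), 0 < n →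
        (∀ v : HeightOneSpectrum (𝓞 K), φ.IsUnramifiedAt v) →
        φ.HasInfinityType (fun _ ↦ (n : ℤ)) (fun _ ↦ -(n : ℤ)) →
        IsPAdicAvatarOf ι φ r → FactorsThroughZp κ r →
        ∃ L : ℂ_[p], HasSum (fun m : ℕ ↦ a m * (avatarValueAt r γ - 1) ^ m) L ∧
          ((ι.symm (bdpInterpolationValue p f 𝔭 φ n 1) : PadicAlgCl p) : ℂ_[p]) * Ωp ^ (4 * n) =
            L * C⁻¹ * (avatarValueAt r σ𝔭 ^ (N.factorization p))⁻¹ := by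
  classical
  have hp : p.Prime := Fact.out
  have hpN : p ∣ N := dvd_trans (dvd_pow_self p two_ne_zero) hp2N
  -- §A the 𝔭-inducing embedding and its Heegner point
  obtain ⟨ιK₀, P₀, hιK₀, hP₀, hlog⟩ :=
    exists_inducing_embedding_and_heegnerPoint ι W K 𝔭 Dt H ιK e P hN hK hι hHN hP
  -- §B the fact at this datum
  obtain ⟨a, Pet, Lad, s, εp, hrad, hPet, hLad, hs, hεp, hL1, hL2⟩ :=
    hF ι W K 𝔭 κ γ Dt H ιK₀ e P₀ f hN hp2N hK hsplit h𝔭 hι hιK₀ he hHN hκ hγ hfW hP₀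
  -- §C the avatar clause from the kernel
  obtain ⟨ϖ, σ𝔭, hϖ, hav⟩ := PNewDisplay.exists_varpi_sigma_symm_heckeValueExtZero_eq ι hK hsplit h𝔭 κ
  -- the embedding `ι⁻¹ : ℂ → ℂ_p` as a ring map
  set em : ℂ →+* ℂ_[p] := (algebraMap (PadicAlgCl p) ℂ_[p]).comp ι.symm.toRingHom with hem
  have hem' : ∀ z : ℂ, ((ι.symm z : PadicAlgCl p) : ℂ_[p]) = em z := fun z ↦ rfl
  have hemι : ∀ x : PadicAlgCl p, em (ι x) = (x : ℂ_[p]) := fun x ↦ by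
    rw [← hem', RingEquiv.symm_apply_apply]
  -- `a_p(f) = 0` at the additive prime
  have hap : cuspCoeff f p = 0 := hfW.1.cuspCoeff_eq_zero_of_sq_dvd hp hp2N
  -- complex constants and their non-vanishing
  have hπ0 : (Real.pi : ℂ) ≠ 0 := by exact_mod_cast Real.pi_ne_zero
  set δs : ℂ := (Real.sqrt |(NumberField.discr K : ℝ)| : ℂ) with hδs
  have hδs0 : δs ≠ 0 := by
    have hd : (0 : ℝ) < |(NumberField.discr K : ℝ)| :=
      abs_pos.mpr (by exact_mod_cast NumberField.discr_ne_zero K)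
    rw [hδs, Ne, Complex.ofReal_eq_zero]
    exact (Real.sqrt_pos.mpr hd).ne'
  set z2 : ℂ := ((Real.pi ^ 2 / 6 : ℝ) : ℂ) with hz2
  have hz20 : z2 ≠ 0 := by
    rw [hz2]; push_cast
    exact div_ne_zero (pow_ne_zero _ hπ0) (by norm_num)
  set L1C : ℂ := ((imagQuadLOne K : ℝ) : ℂ) with hL1C
  have hL1C0 : L1C ≠ 0 := by rw [hL1C]; exact_mod_cast (imagQuadLOne_pos K).ne'
  have hN0 : N ≠ 0 := NeZero.ne N
  have hψpos : (0 : ℝ) < dedekindPsi N :=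
    mul_pos (by exact_mod_cast Nat.pos_of_ne_zero hN0) (Finset.prod_pos fun q _ ↦ by positivity)
  have hB : 0 < badFactor N Lad := badFactor_pos hLad
  have hLAdpos : 0 < adjointLOne N Pet Lad := div_pos (by unfold badFactor at hB; positivity) hψpos
  set LAC : ℂ := ((adjointLOne N Pet Lad : ℝ) : ℂ) with hLAC
  have hLAC0 : LAC ≠ 0 := by rw [hLAC]; exact_mod_cast hLAdpos.ne'
  have hs0 : (s : ℂ) ≠ 0 := by rcases hs with h | h <;> simp [h]
  have hε0 : (εp : ℂ) ≠ 0 := by rcases hεp with h | h <;> simp [h]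
  have hPet0 : (Pet : ℂ) ≠ 0 := by exact_mod_cast hPet.ne'
  have hB0 : ((badFactor N Lad : ℝ) : ℂ) ≠ 0 := by exact_mod_cast hB.ne'
  have hψ0 : ((dedekindPsi N : ℝ) : ℂ) ≠ 0 := by exact_mod_cast hψpos.ne'
  have hh0 : (NumberField.classNumber K : ℂ) ≠ 0 := by
    exact_mod_cast (NumberField.classNumber_pos (K := K)).ne'
  -- the Manin constant is non-zero (Edixhoven 1991 §1, tree theorem)
  have hcZ : Dt.c ≠ 0 := Dt.maninConstant_ne_zero_holds
  have hcMC0 : ((Dt.c : ℤ) : ℂ) ≠ 0 := by exact_mod_cast hcZ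
  -- `p`-adic constants: `ϖ`, the virtual period `λ = ι⁻¹(π²/4)·ϖ^{a}` and its fourth root
  set aN : ℕ := N.factorization p with haN
  set ϖ' : PadicAlgCl p := algebraMap ℚ_[p] (PadicAlgCl p) ϖ with hϖ'
  have hpQ : (p : ℚ_[p]) ≠ 0 := by exact_mod_cast hp.ne_zero
  have hϖ0 : ϖ ≠ 0 := by rcases hϖ with h | h <;> simp [h, hpQ]
  have hϖ'0 : ϖ' ≠ 0 := by
    rw [hϖ']; exact (map_ne_zero_iff _ (algebraMap ℚ_[p] (PadicAlgCl p)).injective).mpr hϖ0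
  set μ : PadicAlgCl p := ι.symm ((Real.pi : ℂ) ^ 2 / 2 ^ 2) with hμ
  have hμ0 : μ ≠ 0 := (map_ne_zero_iff _ ι.symm.injective).mpr
    (div_ne_zero (pow_ne_zero _ hπ0) (pow_ne_zero _ two_ne_zero))
  set lam : PadicAlgCl p := μ * ϖ' ^ aN with hlam
  have hlam0 : lam ≠ 0 := mul_ne_zero hμ0 (pow_ne_zero _ hϖ'0)
  obtain ⟨ω, hω⟩ := IsAlgClosed.exists_pow_nat_eq lam (by norm_num : 0 < 4)
  have hω0 : ω ≠ 0 := fun h0 ↦ hlam0 (by rw [← hω, h0]; norm_num)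
  have hωC0 : (ω : ℂ_[p]) ≠ 0 := by
    rw [← hemι]; exact (map_ne_zero em).mpr ((map_ne_zero_iff _ ι.injective).mpr hω0)
  -- the constant `c = 2π·ζ(2)·εp/(L(1,η)·L(1,Π,Ad))`
  set cC : ℂ := 2 * (Real.pi : ℂ) * z2 * (εp : ℂ) / (L1C * LAC) with hcC
  have hcC0 : cC ≠ 0 :=
    div_ne_zero (mul_ne_zero (mul_ne_zero (mul_ne_zero two_ne_zero hπ0) hz20) hε0) (mul_ne_zero hL1C0 hLAC0)
  -- `w_K = 2`, `p ∤ d_K`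
  have hw2 : NumberField.Units.torsionOrder K = 2 :=
    Literature.NumberTheory.QuadraticFields.Quadratic.torsionOrder_eq_two_of_discr_lt_neg_four hK.1 hd4
  have hdisc : ¬ (p : ℤ) ∣ NumberField.discr K :=
    Literature.SatisfiesHeegnerHypothesis.not_dvd_discr hK.1 hHN hp hpN
  -- the unit `u` (no Manin constant inside)
  set uC : ℂ := 8 / ((s : ℂ) * (2 : ℂ) ^ 2 * δs) with huC
  set u : ℂ_[p] := em uC with hu
  -- the only change against the odd-`p` road: `‖ι⁻¹(2)‖ = ‖2‖_p` is kept symbolic (it is `1` for odd `p`, `1/2` at `p = 2`)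
  have hem2 : em (2 : ℂ) = (2 : ℂ_[p]) := map_ofNat em 2
  have h2pos : (0 : ℝ) < ‖(2 : ℂ_[p])‖ := norm_pos_iff.mpr two_ne_zero
  have h8 : ‖em (8 : ℂ)‖ = ‖(2 : ℂ_[p])‖ ^ 3 := by
    rw [show (8 : ℂ) = 2 ^ 3 by norm_num, map_pow, norm_pow, hem2]
  have hs1 : ‖em (s : ℂ)‖ = 1 := by rcases hs with h | h <;> simp [h]
  have hδs1 : ‖em δs‖ = 1 := PNewDisplay.norm_map_sqrt_discr_eq_one em hdisc
  have hu1 : ‖u‖ = ‖(2 : ℂ_[p])‖ := by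
    rw [hu, huC, map_div₀, norm_div, h8, map_mul, map_mul, norm_mul, norm_mul, hs1,
      map_pow, norm_pow, hem2, hδs1]
    field_simp
  have hcCne : em cC ≠ 0 := (map_ne_zero em).mpr hcC0
  -- the Manin constant read in `ℂ_p` along the two roads `ℤ → ℂ → ℂ_p` and `ℤ → ℚ_p → ℂ_p`
  have hcem : em ((Dt.c : ℤ) : ℂ) = (Dt.c : ℂ_[p]) := map_intCast em Dt.c
  have hcalg : algebraMap ℚ_[p] ℂ_[p] (Dt.c : ℚ_[p]) = (Dt.c : ℂ_[p]) := map_intCast _ Dt.c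
  have hcp0 : (Dt.c : ℂ_[p]) ≠ 0 := by exact_mod_cast hcZ
  have hvalue : u * (algebraMap ℚ_[p] ℂ_[p] (Castella2018.padicLogOmega W p e P / (Dt.c : ℚ_[p]))) ^ 2 =
      a 0 * (em cC)⁻¹ := by
    -- the value: `u·(log P / c)² = a 0 · c⁻¹` from (L2-add) and the printed identities
    set Lg : ℚ_[p] := Castella2018.padicLogOmega W p e P with hLg
    set αC : ℂ := ((heegnerVectorAlpha K N Dt.c Pet Lad s : ℝ) : ℂ) with hαC
    -- `α′ = 4·s·(6πc²Pet·w/(hψ))·B` and its non-vanishing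
    have hα4 : αC = 4 * (s : ℂ) * (6 * (Real.pi : ℂ) * ((Dt.c : ℤ) : ℂ) ^ 2 * (Pet : ℂ) * (2 : ℂ) /
        ((NumberField.classNumber K : ℂ) * ((dedekindPsi N : ℝ) : ℂ)) * ((badFactor N Lad : ℝ) : ℂ)) := by
      rw [hαC, heegnerVectorAlpha_eq_four_mul K N Dt.c Pet Lad s
        (by exact_mod_cast (NumberField.classNumber_pos (K := K)).ne') hψpos.ne', hw2]
      push_cast
      ring
    have hαC0 : αC ≠ 0 := by
      rw [hα4]
      refine mul_ne_zero (mul_ne_zero (by norm_num) hs0)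
        (mul_ne_zero (div_ne_zero ?_ (mul_ne_zero hh0 hψ0)) hB0)
      exact mul_ne_zero (mul_ne_zero (mul_ne_zero (mul_ne_zero (by norm_num) hπ0) (pow_ne_zero _ hcMC0)) hPet0)
        two_ne_zero
    have hαem0 : em αC ≠ 0 := (map_ne_zero em).mpr hαC0
    -- the complex unit identity `uC · α′ · c = (2/h)²·εp·c_M²` and its image under `em`
    have hL1' : L1C = 2 * (Real.pi : ℂ) * (NumberField.classNumber K : ℂ) / ((2 : ℂ) * δs) := by
      rw [hL1C, imagQuadLOne, hw2, hδs]; push_cast; ring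
    have hLA' : LAC = 8 * (Real.pi : ℂ) ^ 3 * (Pet : ℂ) * ((badFactor N Lad : ℝ) : ℂ) /
        ((dedekindPsi N : ℝ) : ℂ) := by
      rw [hLAC, adjointLOne]; push_cast; ring
    have hunitC : uC * (αC * cC) =
        (2 / (NumberField.classNumber K : ℂ)) ^ 2 * (εp : ℂ) * ((Dt.c : ℤ) : ℂ) ^ 2 := by
      rw [huC, hα4, hcC, hL1', hLA', hz2]
      push_cast
      exact manin_unit_identity (s : ℂ) ((Dt.c : ℤ) : ℂ) 2 δs (NumberField.classNumber K : ℂ) (Pet : ℂ)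
        ((badFactor N Lad : ℝ) : ℂ) ((dedekindPsi N : ℝ) : ℂ) (Real.pi : ℂ) (εp : ℂ) hs0 two_ne_zero hδs0
        hh0 hPet0 hB0 hψ0 hπ0 hε0
    have hunitP : u * (em αC * em cC) =
        em ((2 / (NumberField.classNumber K : ℂ)) ^ 2 * (εp : ℂ)) * (Dt.c : ℂ_[p]) ^ 2 := by
      rw [hu, ← map_mul em αC cC, ← map_mul em uC, hunitC, map_mul em, map_pow em, hcem]
    have hvSF : em (((valueSideFactorAdditive εp (NumberField.classNumber K) : ℚ)) : ℂ) =
        em ((2 / (NumberField.classNumber K : ℂ)) ^ 2 * (εp : ℂ)) := by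
      congr 1
      rw [valueSideFactorAdditive]
      push_cast
      ring
    -- (L2-add) in `ℂ_p` atoms: `a 0 · em α′ = em((2/h)²εp) · (alg Lg)²`
    have hL2' : a 0 * em αC = em ((2 / (NumberField.classNumber K : ℂ)) ^ 2 * (εp : ℂ)) *
        (algebraMap ℚ_[p] ℂ_[p] Lg) ^ 2 := by
      have h := hL2
      rw [hem', hem', ← map_pow, hlog, map_pow, hvSF] at h
      exact h
    -- conclude: `u·(alg (Lg/c))² = a 0 · c⁻¹`
    rw [map_div₀, hcalg]
    set E2 : ℂ_[p] := em ((2 / (NumberField.classNumber K : ℂ)) ^ 2 * (εp : ℂ)) with hE2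
    set Lp : ℂ_[p] := algebraMap ℚ_[p] ℂ_[p] Lg with hLp
    have hkey : u * (Lp / (Dt.c : ℂ_[p])) ^ 2 * (em αC * em cC) = a 0 * em αC := by
      rw [mul_right_comm, hunitP, hL2']
      field_simp
    calc u * (Lp / (Dt.c : ℂ_[p])) ^ 2
        = u * (Lp / (Dt.c : ℂ_[p])) ^ 2 * (em αC * em cC) * (em αC * em cC)⁻¹ := by
          rw [mul_inv_cancel_right₀ (mul_ne_zero hαem0 hcCne)]
      _ = a 0 * em αC * (em αC * em cC)⁻¹ := by rw [hkey]
      _ = a 0 * (em cC)⁻¹ := by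
          rw [mul_inv, ← mul_assoc, mul_assoc (a 0), mul_inv_cancel₀ hαem0, mul_one]
  refine ⟨(ω : ℂ_[p]), a, em cC, u, σ𝔭, hωC0, hrad, hcCne, hu1, hvalue.symm, ?_⟩
  intro φ n r hn hunr hinf havt hfac
  refine ⟨_, hL1 φ n r hn hunr hinf havt hfac, ?_⟩
  -- the per-character identity: display = 𝓛(χ) · c⁻¹ · (r(σ𝔭)^{a})⁻¹
  obtain ⟨m, hm⟩ := Nat.exists_eq_add_one_of_ne_zero hn.ne'
  set dP : PadicAlgCl p := ((Matrix.GeneralLinearGroup.det (r σ𝔭) : (PadicAlgCl p)ˣ) :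
    PadicAlgCl p) with hdP
  have hdP0 : dP ≠ 0 := Units.ne_zero _
  have havP : avatarValueAt r σ𝔭 = (dP : ℂ_[p]) := rfl
  -- (AV-p) read in `ℂ`
  have hAV := hav φ n r hn hunr hinf havt hfac
  rw [hm] at hAV
  have hφ𝔭 : heckeValueExtZero φ 𝔭 = ι ϖ' ^ (m + 1) * ι dP := by
    rw [← map_pow, ← map_mul, ← hAV, RingEquiv.apply_symm_apply]
  -- `Ω⁴` read in `ℂ`
  have hOm : ι ω ^ 4 = (Real.pi : ℂ) ^ 2 / 2 ^ 2 * ι ϖ' ^ aN := by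
    rw [← map_pow, hω, hlam, map_mul, map_pow, hμ, RingEquiv.apply_symm_apply]
  have hιdP : ι dP ≠ 0 := (map_ne_zero_iff _ ι.injective).mpr hdP0
  have hιϖ : ι ϖ' ≠ 0 := (map_ne_zero_iff _ ι.injective).mpr hϖ'0
  have hΓ1 : Complex.Gamma ((m + 1 : ℕ) : ℂ) = (Nat.factorial m : ℂ) := by
    rw [Nat.cast_succ, Complex.Gamma_nat_eq_factorial]
  have hΓ2 : Complex.Gamma (((m + 1 : ℕ) : ℂ) + 1) = (Nat.factorial (m + 1) : ℂ) := by
    exact_mod_cast Complex.Gamma_nat_eq_factorial (m + 1)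
  have key := additive_display_term_identity (Nat.factorial (m + 1) : ℂ) (Nat.factorial m : ℂ)
    (rankinSelbergValueHecke f φ 1) (Real.pi : ℂ) z2 L1C LAC (εp : ℂ) (heckeValueExtZero φ 𝔭)
    (ι dP) (ι ϖ') (ι ω) ((p : ℂ))⁻¹ 2 m aN hπ0 hz20 hL1C0 hLAC0 hε0 hιdP hιϖ two_ne_zero hOm hφ𝔭
  -- rewrite the goal as `em` of the complex identity
  simp only [hm]
  rw [hem', hem', havP, ← hemι ω, ← hemι dP, bdpInterpolationValue_of_dvd hpN, hap, hΓ1, hΓ2,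
    ← map_pow em, ← map_pow em, ← map_mul em]
  rw [show interpolationValueAdditive εp aN f 𝔭 φ (m + 1) (imagQuadLOne K) (adjointLOne N Pet Lad) =
    ((Nat.factorial (m + 1) : ℂ) * (Nat.factorial m : ℂ) / (2 * (Real.pi : ℂ)) ^ (2 * (m + 1) - 1)) * z2 *
      rankinSelbergValueHecke f φ 1 / (2 * L1C * LAC) * (2 * (Real.pi : ℂ) ^ (2 * (m + 1) - 1)) *
      ((εp : ℂ) * heckeValueExtZero φ 𝔭 ^ aN) by
    simp only [interpolationValueAdditive, waldspurgerPeriodRatio, archFactor, additiveEpsilonOverLSq,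
      hz2, hL1C, hLAC, Nat.add_sub_cancel]
    push_cast
    ring]
  rw [key, hcC]
  simp only [map_mul, map_inv₀, map_pow]

/-- **The continuous display, Manin-robust, EVERY prime `p`** (limit form of `exists_exactDisplay_manin_anyPrime`; verbatim
`UniversalToricDescentWaldspurgerFlat.exists_continuousDisplay_manin` without `p ≠ 2`): Castella's display of the virtual frame
`(1, Ω_p)` tends to `u·(log_{ω_E} P / c)²`, `‖u‖ = ‖2‖_p`, along EVERY interpolation sequence through `κ` with `r_k(γ) → 1`.
CONDITIONAL on `hF`; nothing booked. [cite: LiuZhangZhang2018, Thm 1.5.1, Remark 1.1.2, Thm 1.5.3 (Duke Math. J. 167 pp. 746–749)]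
[cite: Washington1997, §7.1 (power series on the open unit disc)] -/
theorem exists_continuousDisplay_manin_anyPrime
    (hF : thm151_thm153_modularCurve_heegnerVector_additive)
    (ι : PadicAlgCl p ≃+* ℂ) (W : WeierstrassCurve ℚ) [W.IsElliptic] [W.IsGloballyMinimal]
    (K : Type) [Field K] [NumberField K] (𝔭 : HeightOneSpectrum (𝓞 K))
    (κ : ZpExtension K p) (γ : absoluteGaloisGroup K) {N : ℕ} [NeZero N]
    (Dt : ModularParametrizationData W N) (H : HeegnerDatum N (NumberField.discr K))
    (ιK : K →+* ℂ) (e : K →+* ℚ_[p]) (P : (W.baseChange K).toAffine.Point)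
    (f : CuspForm (CongruenceSubgroup.Gamma0 N) 2)
    (hN : W.conductorNorm ℤ = N) (hp2N : p ^ 2 ∣ N) (hK : IsImaginaryQuadratic K)
    (hd4 : NumberField.discr K < -4) (hsplit : ((Ideal.span {(p : ℤ)}).primesOver (𝓞 K)).ncard = 2)
    (h𝔭 : ((p : ℕ) : 𝓞 K) ∈ 𝔭.asIdeal)
    (hι : ∀ (w' : InfinitePlace K) (k : 𝓞 K), k ∈ 𝔭.asIdeal ↔ ‖ι.symm (w'.embedding (k : K))‖ < 1)
    (hHN : SatisfiesHeegnerHypothesis N K) (hκ : κ.IsAnticyclotomic) (hγ : κ.IsTopGenerator γ)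
    (hfW : IsNewformOf W f)
    (hP : WeierstrassCurve.Affine.Point.map ιK.toRatAlgHom P = heegnerPointComplex Dt H)
    (he : ∀ k : 𝓞 K, k ∈ 𝔭.asIdeal ↔ ‖e (k : K)‖ < 1) :
    ∃ (Ωp u : ℂ_[p]), Ωp ≠ 0 ∧ ‖u‖ = ‖(2 : ℂ_[p])‖ ∧
      ∀ (φ : ℕ → HeckeCharacter K) (n : ℕ → ℕ) (r : ℕ → FramedGaloisRep K (PadicAlgCl p) 1),
        (∀ k, 0 < n k) → (∀ k (v : HeightOneSpectrum (𝓞 K)), (φ k).IsUnramifiedAt v) →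
        (∀ k, (φ k).HasInfinityType (fun _ ↦ (n k : ℤ)) (fun _ ↦ -(n k : ℤ))) →
        (∀ k, IsPAdicAvatarOf ι (φ k) (r k)) → (∀ k, FactorsThroughZp κ (r k)) →
        Tendsto (fun k ↦ avatarValueAt (r k) γ) atTop (𝓝 1) →
        Tendsto (fun k ↦ ((ι.symm (bdpInterpolationValue p f 𝔭 (φ k) (n k) 1) :
          PadicAlgCl p) : ℂ_[p]) * Ωp ^ (4 * n k)) atTop
          (𝓝 (u * (algebraMap ℚ_[p] ℂ_[p] (Castella2018.padicLogOmega W p e P / (Dt.c : ℚ_[p]))) ^ 2)) := by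
  obtain ⟨Ωp, a, C, u, σ𝔭, hΩp, hrad, hC, hu, hval, hdisp⟩ :=
    exists_exactDisplay_manin_anyPrime hF ι W K 𝔭 κ γ Dt H ιK e P f hN hp2N hK hd4 hsplit h𝔭 hι hHN hκ hγ hfW hP he
  refine ⟨Ωp, u, hΩp, hu, ?_⟩
  intro φ n r hn hunr hinf havt hfac hlimγ
  choose L hL hdL using fun k ↦ hdisp (φ k) (n k) (r k) (hn k) (hunr k) (hinf k) (havt k) (hfac k)
  have hσ : ∀ σ : absoluteGaloisGroup K, Tendsto (fun k ↦ avatarValueAt (r k) σ) atTop (𝓝 1) := by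
    intro σ
    rw [Metric.tendsto_nhds]
    intro ε hε
    filter_upwards [PNewDisplay.eventually_forall_norm_avatarValueAt_sub_one_lt hγ hfac hlimγ hε] with k hk
    rw [dist_eq_norm]
    exact hk σ
  obtain ⟨B, hB⟩ := hrad (1 / 2) (by norm_num) (by norm_num)
  have hx : Tendsto (fun k ↦ avatarValueAt (r k) γ - 1) atTop (𝓝 0) := by
    have h := hlimγ.sub_const 1
    rwa [sub_self] at h
  have hlimL : Tendsto L atTop (𝓝 (a 0)) :=
    tendsto_value_of_tendsto_zero_of_coeff_bound (ρ := 1 / 2) (by norm_num) hB hx hL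
  have hlim : Tendsto (fun k ↦ L k * C⁻¹ * (avatarValueAt (r k) σ𝔭 ^ (N.factorization p))⁻¹) atTop
      (𝓝 (a 0 * C⁻¹ * ((1 : ℂ_[p]) ^ (N.factorization p))⁻¹)) :=
    (hlimL.mul tendsto_const_nhds).mul (((hσ σ𝔭).pow _).inv₀ (by simp))
  rw [show (fun k ↦ ((ι.symm (bdpInterpolationValue p f 𝔭 (φ k) (n k) 1) : PadicAlgCl p) : ℂ_[p]) *
      Ωp ^ (4 * n k)) = (fun k ↦ L k * C⁻¹ * (avatarValueAt (r k) σ𝔭 ^ (N.factorization p))⁻¹) from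
    funext hdL]
  simpa only [one_pow, inv_one, mul_one, hval] using hlim

end Rescale

end Summit.BirchSwinnertonDyer.BirchSwinnertonDyer.Theorems.PrintCf2.EisensteinTwo

end
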